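import Summits.BirchSwinnertonDyer.Rank1Residual.X11b.MaxUnramifiedRestriction
import Literature.NumberTheory.EllipticCurves.Kato2004.StrictSelmerH2Count
import Literature.NumberTheory.EllipticCurves.IwasawaCoinvariantsRankProofs
import Literature.NumberTheory.EllipticCurves.H1UnramifiedFinite
import HarnessLib

/-!
# The two currencies for Kato's strict Selmer group of `W[p^∞]` agree: the Selmer group of a `SelmerStructure (primaryGaloisModule W p)`
# with local conditions `⊥` on `P`, `unramifiedSubgroup` off `P`, `⊤` at `∞` IS the Literature subgroup `Kato2004.katoStrictSelmer W p P`
# (route `KatoDescentPotSupersingular` / `…Tame…`, crux M = stmt-BirchSwinnertonDyer-19196; route-free helper)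

Seat `bsd-potss-rkm` g21 (prover; cell `bsd-potss`), item stmt-BirchSwinnertonDyer-19196 (`--supports … --as helper`; closes nothing).
HONEST FRAMING: BSD is not proved by any of this; nothing is booked; theorems only (no definition, no named fact).

## What

The crux-M ledger (`Theorems/KatoDescentPotSupersingularKatoFiniteLevel*`, `…ASide*`, parts 1–58) reads `Sel_str^{ur}(ℚ, W[p^∞])` as
`𝓢inf.selmerGroup` for a Selmer structure `𝓢inf` on the discrete module `primaryGaloisModule W p` (X11b `LocalTrivialityBridge`) with
`𝓢inf (Sum.inr v_p) = ⊥`, `𝓢inf (Sum.inr v) = unramifiedSubgroup (toLocal v ·) 1` for `v ≠ v_p`, `𝓢inf (Sum.inl w) = ⊤`.  The Literature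
predicate `Kato2004.KatoH2CountAt` (p629720) reads it as `Kato2004.katoStrictSelmer W p {v_p}` — classes of `H¹(Γ_ℚ, W[p^∞])` principal on
the decomposition group `GreenbergSelmer.decomp v_p` and on the inertia groups of the chosen primes `adicCompletionPrime ℚ v`, `v ≠ v_p`
(`SelmerUnramified` currency; a Literature file cannot import X11b).  This file proves they are the SAME subgroup of the same group:

* `res_primaryGaloisModule_oneCocycleClass` — restriction `H¹(K, W[p^∞]) → H¹(E, W[p^∞])` on explicit cocycles (`map_oneCocycleClass`);
* `localization_primary_mem_unramifiedSubgroup_iff_mem_unramifiedKer` — `loc_v c ∈ H¹_ur(K_v, W[p^∞]) ↔ c ∈ unramifiedKer W[p^∞] 𝔓_v`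
  (the `W[p^∞]`-analogue of X10 `localization_mem_unramifiedSubgroup_iff_mem_unramifiedKer`: `I_{𝔓_v} = res (absInertia K_v)`);
* `localization_primary_eq_zero_iff_mem_subgroupResKer` — `loc_v c = 0 ↔ c ∈ subgroupResKer W[p^∞] (decomp v)` (X11b `localization_inr_eq_zero_iff`);
* **`selmerGroup_eq_katoStrictSelmer`** (any number field `K : Type`, any set `P` of finite places) and, over `ℚ` with `P = {primePlace p}` in
  the hypotheses' spelling of the ledger, **`selmerGroup_eq_katoStrictSelmer_rat`**, **`natCard_selmerGroup_eq_natCard_katoStrictSelmer`**.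

References: K. Kato, Astérisque 295 (2004), §8.2 (p. 181), §14.1, (14.9.3) (p. 240) [Kato2004Asterisque]; R. Greenberg, LNM 1716 §2 [GreenbergLNM1716];
J. Neukirch, *ANT* II (9.6) [NeukirchANT1999]; J. S. Milne, *ADT* I §2 [MilneADT2006].
-/

-- the summit and its single problem are both named `BirchSwinnertonDyer` (registry layout D-0017)
set_option linter.dupNamespace false
set_option autoImplicit false

noncomputable section

open scoped Classical NumberField
open CategoryTheory Function Field NumberField IsDedekindDomain WeierstrassCurve
open Literature.NumberTheory.EllipticCurves Literature.NumberTheory.EllipticCurves.GreenbergSelmer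
  Literature.NumberTheory.EllipticCurves.ResKernel
open Literature.NumberTheory.GaloisRepresentations Literature.NumberTheory.GaloisRepresentations.IsNonarchimedeanLocalField
open Literature.NumberTheory.GaloisRepresentations.DiscreteGaloisModule (unramifiedSubgroup SelmerStructure)
open Literature.NumberTheory.EllipticCurves.Kato2004
open Summit.BirchSwinnertonDyer.Rank1Residual.X11b.LocBridge

namespace Summit.BirchSwinnertonDyer.BirchSwinnertonDyer.Theorems.StrictSelmerBridge

section Bridge

variable {K : Type} [Field K] [NumberField K] (W : WeierstrassCurve K) (p : ℕ)

omit [NumberField K] in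
/-- The restriction `res_E : H¹(K, W[p^∞]) → H¹(Γ_E, W[p^∞])` on classes of continuous crossed homomorphisms: `[φ] ↦ [φ ∘ res]`
(as `res_torsionGaloisModule_oneCocycleClass` for `W[n]`). [cite: MilneADT2006, Ch. I §2 (restriction)] -/
theorem res_primaryGaloisModule_oneCocycleClass (E : Type) [Field E] [Algebra K E]
    (φ : contOneCocycles (discreteTopRep (absoluteGaloisGroup K) (geomPrimaryTorsion W p))) :
    galoisCohomology.res (primaryGaloisModule W p) E 1
        (oneCocycleClass (discreteTopRep (absoluteGaloisGroup K) (geomPrimaryTorsion W p)) φ) =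
      oneCocycleClass
        (DiscreteGaloisModule.toTopRep (GaloisRep.restrictField E (primaryGaloisModule W p)))
        (contOneCocycles.pullback (absGaloisRestrict K E)
          (X := discreteTopRep (absoluteGaloisGroup K) (geomPrimaryTorsion W p))
          (Y := DiscreteGaloisModule.toTopRep (GaloisRep.restrictField E (primaryGaloisModule W p)))
          (TopRep.ofHom ⟨ContinuousLinearMap.id ℤ (geomPrimaryTorsion W p), fun _ => rfl⟩) φ) :=
  map_oneCocycleClass _ _ _ φ

/-- **`loc_v c ∈ H¹_ur(K_v, W[p^∞]) ↔ c ∈ unramifiedKer (W[p^∞]) 𝔓_v`**: the unramified subgroup of the local module at `v` pulled back to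
`H¹(K, W[p^∞])` is the `SelmerUnramified` kernel at the chosen prime `𝔓_v = adicCompletionPrime K v`, because `I_{𝔓_v} = res (absInertia K_v)`
(`inertia_adicCompletionPrime_eq_map_absInertia`).  The `W[p^∞]`-analogue of X10's `localization_mem_unramifiedSubgroup_iff_mem_unramifiedKer`.
[cite: MilneADT2006, Ch. I §2 (unramified cohomology)] [cite: NeukirchANT1999, Ch. II §9 Prop. (9.6)] -/
theorem localization_primary_mem_unramifiedSubgroup_iff_mem_unramifiedKer (v : HeightOneSpectrum (𝓞 K)) (c : galH1Primary W p) :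
    galoisCohomology.localization (primaryGaloisModule W p) (Sum.inr v) 1 c ∈
        unramifiedSubgroup (GaloisRep.toLocal v (primaryGaloisModule W p)) 1 ↔
      c ∈ unramifiedKer (geomPrimaryTorsion W p) (adicCompletionPrime K v) := by
  obtain ⟨φ, rfl⟩ :=
    oneCocycleClass_surjective (discreteTopRep (absoluteGaloisGroup K) (geomPrimaryTorsion W p)) c
  change galoisCohomology.res (primaryGaloisModule W p) (v.adicCompletion K) 1
      (oneCocycleClass (discreteTopRep (absoluteGaloisGroup K) (geomPrimaryTorsion W p)) φ) ∈
      unramifiedSubgroup (GaloisRep.restrictField (v.adicCompletion K) (primaryGaloisModule W p)) 1 ↔ _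
  rw [res_primaryGaloisModule_oneCocycleClass]
  refine (mem_unramifiedSubgroup_one_iff_exists _ _).trans ?_
  rw [unramifiedKer, oneCocycleClass_mem_subgroupResKer_iff]
  constructor
  · rintro ⟨w, hw⟩
    refine ⟨w, fun σ ↦ ?_⟩
    have hσ : (σ : absoluteGaloisGroup K) ∈
        (absInertia (v.adicCompletion K)).map (absGaloisRestrict K (v.adicCompletion K)).toMonoidHom := by
      rw [← inertia_adicCompletionPrime_eq_map_absInertia]; exact σ.2
    obtain ⟨τ, hτ, hτσ⟩ := Subgroup.mem_map.mp hσ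
    have h := hw τ hτ
    rw [contOneCocycles.pullback_apply] at h
    change φ.1 (absGaloisRestrict K (v.adicCompletion K) τ) =
      absGaloisRestrict K (v.adicCompletion K) τ • w - w at h
    have hτσ' : absGaloisRestrict K (v.adicCompletion K) τ = (σ : absoluteGaloisGroup K) := hτσ
    rw [hτσ'] at h
    exact h
  · rintro ⟨a, ha⟩
    refine ⟨a, fun τ hτ ↦ ?_⟩
    have hmem : absGaloisRestrict K (v.adicCompletion K) τ ∈
        (adicCompletionPrime K v).inertia (absoluteGaloisGroup K) := by
      rw [inertia_adicCompletionPrime_eq_map_absInertia]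
      exact Subgroup.mem_map.mpr ⟨τ, hτ, rfl⟩
    have h := ha ⟨_, hmem⟩
    rw [contOneCocycles.pullback_apply]
    change φ.1 (absGaloisRestrict K (v.adicCompletion K) τ) =
      absGaloisRestrict K (v.adicCompletion K) τ • a - a
    exact h

/-- **`loc_v c = 0 ↔ c ∈ subgroupResKer (W[p^∞]) (decomp v)`**: local triviality at the finite place `v` in `H¹(K_v, W[p^∞])` is principality on
the decomposition group of the chosen embedding (X11b `localization_inr_eq_zero_iff`, `primaryGaloisModule = ofSMul E[p^∞]`).
[cite: GreenbergLNM1716, §2] -/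
theorem localization_primary_eq_zero_iff_mem_subgroupResKer (v : HeightOneSpectrum (𝓞 K)) (c : galH1Primary W p) :
    galoisCohomology.localization (primaryGaloisModule W p) (Sum.inr v) 1 c = 0 ↔
      c ∈ subgroupResKer (geomPrimaryTorsion W p) (decomp v) :=
  (localization_inr_eq_zero_iff (isOpen_stabilizer_geomPrimaryTorsion W p) v c).trans
    (mem_subgroupResKer_iff (N := decomp v) (M := geomPrimaryTorsion W p) c).symm

omit [NumberField K] in
/-- Membership in `Kato2004.katoStrictSelmer W p P` (stated at the type `galH1Primary W p` of the Literature definition, so that the membership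
instance path is the Literature one). [cite: Kato2004Asterisque, §14.1 and (14.9.3) (p. 240)] -/
theorem mem_katoStrictSelmer_iff [NumberField K] (P : Set (HeightOneSpectrum (𝓞 K))) (c : galH1Primary W p) :
    c ∈ katoStrictSelmer W p P ↔
      (∀ v : HeightOneSpectrum (𝓞 K), v ∈ P → c ∈ subgroupResKer (geomPrimaryTorsion W p) (decomp v)) ∧
        ∀ v : HeightOneSpectrum (𝓞 K), v ∉ P → c ∈ unramifiedKer (geomPrimaryTorsion W p) (adicCompletionPrime K v) := by
  simp only [katoStrictSelmer, AddSubgroup.mem_inf, AddSubgroup.mem_iInf]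

/-- **The two currencies agree**: for a Selmer structure `𝓢` on `W[p^∞]` with local condition `⊥` at the places of `P`, `unramifiedSubgroup` at the
finite places outside `P` and `⊤` at the infinite places, `𝓢.selmerGroup = Kato2004.katoStrictSelmer W p P`.
[cite: Kato2004Asterisque, §8.2 (p. 181), §14.1 and (14.9.3) (p. 240)] -/
theorem selmerGroup_eq_katoStrictSelmer (𝓢 : SelmerStructure (primaryGaloisModule W p)) (P : Set (HeightOneSpectrum (𝓞 K)))
    (hSP : ∀ v : HeightOneSpectrum (𝓞 K), v ∈ P → 𝓢 (Sum.inr v) = ⊥)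
    (hSur : ∀ v : HeightOneSpectrum (𝓞 K), v ∉ P → 𝓢 (Sum.inr v) = unramifiedSubgroup (GaloisRep.toLocal v (primaryGaloisModule W p)) 1)
    (hSinl : ∀ w : InfinitePlace K, 𝓢 (Sum.inl w) = ⊤) :
    𝓢.selmerGroup = katoStrictSelmer W p P := by
  -- membership is compared through explicit `Iff` terms (the two libraries spell the element type of `H¹(K, W[p^∞])` differently;
  -- no `rw` across the two instance paths)
  refine AddSubgroup.ext fun c => ?_
  refine (DiscreteGaloisModule.SelmerStructure.mem_selmerGroup_iff 𝓢 c).trans ?_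
  refine Iff.trans ?_ (mem_katoStrictSelmer_iff W p P c).symm
  constructor
  · intro h
    refine ⟨fun v hv => ?_, fun v hv => ?_⟩
    · have hv' := h (Sum.inr v)
      rw [hSP v hv, AddSubgroup.mem_bot] at hv'
      exact (localization_primary_eq_zero_iff_mem_subgroupResKer W p v c).mp hv'
    · have hv' := h (Sum.inr v)
      rw [hSur v hv] at hv'
      exact (localization_primary_mem_unramifiedSubgroup_iff_mem_unramifiedKer W p v c).mp hv'
  · rintro ⟨hP, hnP⟩ v
    rcases v with w | v
    · rw [hSinl w]; exact AddSubgroup.mem_top _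
    · by_cases hv : v ∈ P
      · rw [hSP v hv, AddSubgroup.mem_bot]
        exact (localization_primary_eq_zero_iff_mem_subgroupResKer W p v c).mpr (hP v hv)
      · rw [hSur v hv]
        exact (localization_primary_mem_unramifiedSubgroup_iff_mem_unramifiedKer W p v c).mpr (hnP v hv)

end Bridge

/-! ## Over `ℚ`, in the ledger's spelling (`v ≠ primePlace p`) -/

section Rat

variable (W : WeierstrassCurve ℚ) (p : ℕ) [Fact p.Prime] (𝓢inf : SelmerStructure (primaryGaloisModule W p))

/-- **Over `ℚ`: `𝓢inf.selmerGroup = Kato2004.katoStrictSelmer W p {primePlace p}`** for the ledger's strict-unramified structure.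
[cite: Kato2004Asterisque, §14.1 and (14.9.3) (p. 240)] -/
theorem selmerGroup_eq_katoStrictSelmer_rat
    (hSp : 𝓢inf (Sum.inr (primePlace p)) = ⊥)
    (hSur : ∀ v : HeightOneSpectrum (𝓞 ℚ), v ≠ primePlace p →
      𝓢inf (Sum.inr v) = unramifiedSubgroup (GaloisRep.toLocal v (primaryGaloisModule W p)) 1)
    (hSinl : ∀ w : InfinitePlace ℚ, 𝓢inf (Sum.inl w) = ⊤) :
    𝓢inf.selmerGroup = katoStrictSelmer W p {primePlace p} :=
  selmerGroup_eq_katoStrictSelmer W p 𝓢inf {primePlace p} (fun v hv => by rw [Set.mem_singleton_iff.mp hv]; exact hSp)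
    (fun v hv => hSur v (fun h => hv (Set.mem_singleton_iff.mpr h))) hSinl

/-- **Over `ℚ`: `#𝓢inf.selmerGroup = #Kato2004.katoStrictSelmer W p {primePlace p}`** — the count of the crux-M ledger (`Nat.card 𝓢inf.selmerGroup`,
parts 39–58) in the currency of the Literature predicate `Kato2004.KatoH2CountAt`. [cite: Kato2004Asterisque, (14.9.3) (p. 240) and (14.14.2) (p. 243)] -/
theorem natCard_selmerGroup_eq_natCard_katoStrictSelmer
    (hSp : 𝓢inf (Sum.inr (primePlace p)) = ⊥)
    (hSur : ∀ v : HeightOneSpectrum (𝓞 ℚ), v ≠ primePlace p →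
      𝓢inf (Sum.inr v) = unramifiedSubgroup (GaloisRep.toLocal v (primaryGaloisModule W p)) 1)
    (hSinl : ∀ w : InfinitePlace ℚ, 𝓢inf (Sum.inl w) = ⊤) :
    Nat.card 𝓢inf.selmerGroup = Nat.card (katoStrictSelmer W p {primePlace p}) := by
  rw [selmerGroup_eq_katoStrictSelmer_rat W p 𝓢inf hSp hSur hSinl]; rfl

end Rat

end Summit.BirchSwinnertonDyer.BirchSwinnertonDyer.Theorems.StrictSelmerBridge

end
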